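import Literature.MathematicalPhysics.QuantumFieldTheory.Balaban1983to89.Node00.CarriersB8SubBP2DPerKappa
import Literature.MathematicalPhysics.QuantumFieldTheory.Balaban1983to89.B8LeafModelZdHP2PerTransfer
import Literature.MathematicalPhysics.QuantumFieldTheory.Balaban1983to89.B8PeriodicMemberGeometry

/-!
# BalabanUVNodes ∕ N05 ([Balaban1985RegularSpaces] Lemma 1 p. 79 – Thm 8 p. 101, p. 77 «Ω_j ⊂ T_η», (1.3)–(1.4) p. 77): P4 FILE 1 — THE ℤᵈ «P₂D» SLOT OF RECORD
# PASSES TO THE (β′-PERIODIC) δ₂-SLOT AND TO ITS κ-CUT (director-ym №217 (ii) ∕ №220 A-4 ∕ №222 A-5′; plan WORD-P4-AMENDED «(ii) RATIFIED»)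

Track A of `YM-PLAN.md` (cell `pub-ymgap`, HUMAN RULING D-0062), node **N05**; seat `pub-ymgap-dag-n05-d` (g14, P4 pen), 2026-08-28; bears on K1⁹ `stmt-QuantumFields-27364`
(`--supports … --as helper`, count-neutral).

WHAT (pure bookkeeping, conjunct by conjunct, BY NAME): for a periodic residual layer `lamPer : ResidB8Per θ P` whose ℤᵈ base carries this seat's «P₂D» slot
`B8LeafOfRecordSubBP₂D θ lamPer.base` (the `B8LeafRSC` leaf over `zdGF3HP₂` at the (1.5)-index `IdxB8SubD θ`), dag-n05-w1's periodic δ₂-slot `B8LeafOfRecordSubBP₂DPer θ P lamPer`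
(`B8LeafRS` over `famB8OfRecordSubBP₂DPer θ β len P j := zdGF3HP₂Per θ.𝔸 θ.L β len j.toZdIdx P`, P2′ p642573) holds as soon as the two PERIODIC-ONLY conjuncts are supplied —
Theorem 8's surviving form `t8Per` at the periodic members (this seat's CLAIM-7 `B8Thm8SurvivingZdGF3HP2PerMapLanEGamma`, E8a) and the display's Proposition-7 slot `p7Per` at
`lamPer.toAxial` (junk-inhabitable; content only once `toAxial` is print's — K1 census):
* `l1`, `p5e`, `p5u`, `p6` are index-free and carried verbatim;
* `t2`, `t4` by dag-n05-c's transfer′ `B8LeafModelZdHP2PerTransfer.thm2Printed_hp2per_of_zd` ∕ `thm4Printed_hp2per_of_zd` along `ι := IdxB8SubDPer.toZdIdx`, `p := fun _ => P`,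
  its four binders discharged MEMBER-WISE BY NAME: `hΩ := j.periodic`, `hdvd := j.dvd`, `hΛs := j.isPeriodic_Λs le_rfl`, `hΛbP := IdxB8SubD.isPeriodic_towerBondsP_Λs j.1 …`
  (dag-n05-w2's periodic towers p63648x ∕ `B8PeriodicMemberGeometry` §3);
* `p3` by dag-n05-w1's `b8LeafOfRecordSubBP₂DPer_p3_of_subBP₂D` (P1′'s pure-∀ transfer).
Then dag-n05-w1's K2 restriction `b8LeafOfRecordSubBP₂DPerκ_of_subBP₂DPer` gives the κ-CUT slot `B8LeafOfRecordSubBP₂DPerκ θ P M₁ R lamPer` at EVERY pinned pair `(M₁, R)`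
(print's (1.3)–(1.4) class at block size `M₁`, FLAG №10 ∕ A-5′ (i)).

WHAT IS PROVED (three theorems; no estimate; no new definition):
* ★★★ `b8LeafOfRecordSubBP₂DPer_of_subBP₂D` — ℤᵈ P₂D slot + `t8Per` + `p7Per` ⊢ the periodic δ₂-slot.
* ★★★ `b8LeafOfRecordSubBP₂DPerκ_of_subBP₂D` — the same ⊢ the κ-cut periodic δ₂-slot at any `(M₁, R)`.
* `transferHyps_idxB8SubDPer` — the four transfer′ binders at the periodic (1.5)-index, packaged once (bookkeeping).
HONEST FRAMING: bookkeeping only (restriction of the family index + dag-n05-c's translation-covariance transfers BY NAME); 0 estimates of Bałaban's proved here; the two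
periodic-only conjuncts are DISPLAYED hypotheses (`t8Per` = CLAIM-7's target; `p7Per` = the display's free slot); count-neutral; **N05 NOT discharged**; K1⁹ NOT claimed; FLAG №10
NOT closed by this file (A-5′ (ii) is dag-n24-w1's instance); Bałaban AS PRINTED (Thm 8 in its SURVIVING form, GAPS G-B8-13); one finite 𝕋⁴ programme at fixed ε; nothing
continuum ∕ ℝ⁴ ∕ OS ∕ mass-gap ∕ Clay.  No `sorry`, no new definition.  Unit `pub-ymgap-dag-n05-d` (g14).
[cite: Balaban1985RegularSpaces, Lemma 1 – Thm 8 pp.79–101, (1.3)–(1.5) p.77, p.77 («Ω_j ⊂ T_η»), (1.31) p.82; Balaban1985BackgroundPropagators, (3.40) p.397, Thm 3.3 p.399]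
-/

noncomputable section

namespace Summit.QuantumFields.YangMills.BalabanUVNodes.N05SubBP2DPerKappaSlotOfZd

open Literature.MathematicalPhysics.QuantumFieldTheory.Balaban1983to89
open Literature.MathematicalPhysics.QuantumFieldTheory.Balaban1983to89.Node00
open Literature.MathematicalPhysics.QuantumFieldTheory.Balaban1983to89.B8LeafModelZd (ZdIdx)
open Literature.MathematicalPhysics.QuantumFieldTheory.Balaban1983to89.B8LeafModelZd3P2 (zdGF3HP₂ zdGF3P₂)
open Literature.MathematicalPhysics.QuantumFieldTheory.Balaban1983to89.B8LeafModelZdHP2Per (zdGF3HP₂Per)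
open Literature.MathematicalPhysics.QuantumFieldTheory.Balaban1983to89.B8TowerBondsPrinted (towerBondsP)
open Literature.MathematicalPhysics.QuantumFieldTheory.Balaban1983to89.B8LeafModelZdHP2PerTransfer (thm2Printed_hp2per_of_zd thm4Printed_hp2per_of_zd)
open T4TermwiseTorus (IsPeriodic)

variable {θ : Stage3Params} {P : ℕ}

/-! ## §1. The four transfer′ binders at the periodic (1.5)-index, member-wise BY NAME -/

/-- **THE PERIODIC (1.5)-INDEX DISCHARGES transfer′'s FOUR BINDERS** at `ι := IdxB8SubDPer.toZdIdx`, `p := fun _ => P`: every `Ω_l` is `P`-periodic (the index's law),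
`θ.L ^ k ∣ P` (the tiling law), every constraint family `Λs k l` (`l ≤ k`) is `(P ∕ θ.Lˡ)`-periodic (dag-n05-w2's periodic towers, by rigidity), and every `κ`-section of print's
bond class `towerBondsP θ.L Ω (Λs k) l` is `(P ∕ θ.Lˡ)`-periodic (`B8PeriodicMemberGeometry` §3 at `T = θ.Lˡ·(P ∕ θ.Lˡ) = P`).
[cite: Balaban1985RegularSpaces, (1.3)–(1.5) p.77, p.77 («Ω_j ⊂ T_η»), (1.31) p.82 (bookkeeping)] -/
theorem transferHyps_idxB8SubDPer (θ : Stage3Params) (P : ℕ) :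
    (∀ (j : IdxB8SubDPer θ P) (l : ℕ), IsPeriodic P (fun x : B7Prop1Explicit.Site θ.D => x ∈ j.toZdIdx.Ω l)) ∧
    (∀ j : IdxB8SubDPer θ P, θ.L ^ j.toZdIdx.k ∣ P) ∧
    (∀ (j : IdxB8SubDPer θ P) (l : ℕ), l ≤ j.toZdIdx.k →
      IsPeriodic (P / θ.L ^ l) (fun y : B7Prop1Explicit.Site θ.D => y ∈ j.toZdIdx.Λs j.toZdIdx.k l)) ∧
    (∀ (j : IdxB8SubDPer θ P) (l : ℕ), l ≤ j.toZdIdx.k → ∀ κ : Fin θ.D,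
      IsPeriodic (P / θ.L ^ l) (fun z : B7Prop1Explicit.Site θ.D => (z, κ) ∈ towerBondsP θ.L j.toZdIdx.Ω (j.toZdIdx.Λs j.toZdIdx.k) l)) :=
  ⟨fun j l => j.periodic l, fun j => j.dvd, fun j _ hl => j.isPeriodic_Λs le_rfl hl,
    fun j _ hl κ => B8PeriodicMemberGeometry.IdxB8SubD.isPeriodic_towerBondsP_Λs j.1 (fun l _ => j.periodic l) le_rfl hl (j.pow_mul_div hl).symm κ⟩

/-! ## §2. The ℤᵈ «P₂D» slot passes to the periodic δ₂-slot and to its κ-cut -/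

/-- ★★★ **THE ℤᵈ «P₂D» SLOT OF RECORD PASSES TO THE (β′-PERIODIC) δ₂-SLOT**, given the two periodic-only conjuncts: for `lamPer : ResidB8Per θ P` with
`B8LeafOfRecordSubBP₂D θ lamPer.base`, Theorem 8's surviving form `t8Per` over the periodic δ₂-family and the Proposition-7 slot `p7Per` at `lamPer.toAxial`,
dag-n05-w1's `B8LeafOfRecordSubBP₂DPer θ P lamPer` holds — `l1 ∕ p5e ∕ p5u ∕ p6` verbatim, `t2 ∕ t4` by dag-n05-c's transfer′ along `toZdIdx` (binders by §1),
`p3` by `b8LeafOfRecordSubBP₂DPer_p3_of_subBP₂D`.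
[cite: Balaban1985RegularSpaces, Lemma 1 p.79, Thm 2 p.83, Prop. 3 p.87, Thm 4 p.88, Prop. 5 p.94, Prop. 6 p.99, Prop. 7 p.100, Thm 8 p.101 (surviving form), p.77 («Ω_j ⊂ T_η»)] -/
theorem b8LeafOfRecordSubBP₂DPer_of_subBP₂D (lamPer : ResidB8Per θ P) (h : B8LeafOfRecordSubBP₂D θ lamPer.base)
    (t8Per : B8Thm8Surviving.Thm8SurvivingAt 1 lamPer.base.B₁ lamPer.base.B₂ (famB8OfRecordSubBP₂DPer θ lamPer.base.β lamPer.base.len P))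
    (p7Per : B8SectGH.Prop7PrintedR (famB8OfRecordSubBP₂DPer θ lamPer.base.β lamPer.base.len P) lamPer.toAxial) :
    B8LeafOfRecordSubBP₂DPer θ P lamPer where
  l1 := h.l1
  t2 := thm2Printed_hp2per_of_zd (𝔸 := θ.𝔸) (β := lamPer.base.β) (len := lamPer.base.len) (le_trans one_le_two θ.two_le_L)
    (fun j : IdxB8SubDPer θ P => j.toZdIdx) (fun _ => P) (transferHyps_idxB8SubDPer θ P).1 (transferHyps_idxB8SubDPer θ P).2.1
    (transferHyps_idxB8SubDPer θ P).2.2.1 (transferHyps_idxB8SubDPer θ P).2.2.2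
    (B8LeafKnit.thm2Printed_precomp (fun j : IdxB8SubDPer θ P => j.toSubD)
      (fun i : IdxB8SubD θ => (famB8OfRecordSubBP₂D θ lamPer.base.β lamPer.base.len i).toGFData) h.t2)
  p3 := b8LeafOfRecordSubBP₂DPer_p3_of_subBP₂D lamPer h
  t4 := thm4Printed_hp2per_of_zd (𝔸 := θ.𝔸) (β := lamPer.base.β) (len := lamPer.base.len) (le_trans one_le_two θ.two_le_L)
    (fun j : IdxB8SubDPer θ P => j.toZdIdx) (fun _ => P) (transferHyps_idxB8SubDPer θ P).1 (transferHyps_idxB8SubDPer θ P).2.1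
    (transferHyps_idxB8SubDPer θ P).2.2.1 (transferHyps_idxB8SubDPer θ P).2.2.2
    (B8LeafKnit.thm4Printed_precomp (fun j : IdxB8SubDPer θ P => j.toSubD) lamPer.base.B₁'
      (fun i : IdxB8SubD θ => (famB8OfRecordSubBP₂D θ lamPer.base.β lamPer.base.len i).toGFData) h.t4)
  p5e := h.p5e
  p5u := h.p5u
  p6 := h.p6
  p7 := p7Per
  t8 := t8Per

/-- ★★★ **… AND TO ITS κ-CUT AT EVERY PINNED PAIR `(M₁, R)`** (dag-n05-w1's K2 restriction `b8LeafOfRecordSubBP₂DPerκ_of_subBP₂DPer`): print's (1.3)–(1.4) class at block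
size `M₁` (FLAG №10 ∕ director-ym №222 A-5′ (i)). [cite: Balaban1985RegularSpaces, (1.3)–(1.4) p.77, Lemma 1 – Thm 8 pp.79–101 (bookkeeping: restriction of the family index)] -/
theorem b8LeafOfRecordSubBP₂DPerκ_of_subBP₂D (M₁ R : ℕ) (lamPer : ResidB8Per θ P) (h : B8LeafOfRecordSubBP₂D θ lamPer.base)
    (t8Per : B8Thm8Surviving.Thm8SurvivingAt 1 lamPer.base.B₁ lamPer.base.B₂ (famB8OfRecordSubBP₂DPer θ lamPer.base.β lamPer.base.len P))
    (p7Per : B8SectGH.Prop7PrintedR (famB8OfRecordSubBP₂DPer θ lamPer.base.β lamPer.base.len P) lamPer.toAxial) :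
    B8LeafOfRecordSubBP₂DPerκ θ P M₁ R lamPer :=
  b8LeafOfRecordSubBP₂DPerκ_of_subBP₂DPer lamPer (b8LeafOfRecordSubBP₂DPer_of_subBP₂D lamPer h t8Per p7Per)

end Summit.QuantumFields.YangMills.BalabanUVNodes.N05SubBP2DPerKappaSlotOfZd

end
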